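import Summits.QuantumFields.GaugeBoot.ZdMultiAxisReflections
import Summits.QuantumFields.GaugeBoot.ClassBLimitSymmetry
import HarnessLib

/-!
# Reflections of the infinite-lattice bootstrap: the full hyperoctahedral space group `B_d ⋉ ℤ^d` costs at most two levels (gauge-boot, L1/L4 supplement)

HONEST FRAMING (cell `pub-gaugeboot`, page 1 of every file): the venture produces certified bounds
on lattice expectations at stated coupling, gauge group, dimension and torus size; NOT a mass gap,
NOT a continuum limit, NOT a string tension; NOT Yang–Mills-summit-bearing (barriers
`FixedCouplingUltralocality`, `PerturbativeInvisibility`). Structural; it certifies no number.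

## Content (`SU(N)` on `ℤ^d`, one-link Wilson boundary actions, any real `β`, word level `n`)

Kazakov–Zheng reduce the infinite-lattice SDP by the FULL lattice symmetry group: translations
(`BootstrapTranslationReductionZd`), axis permutations (`BootstrapSpaceGroupReductionZd`) AND the
reflections. The first two relabel links and are lossless up to the objective's average; the
reflections reverse links, and a left row of a reversed link is a RIGHT row, available at word level
`n` only from the left rows at level `n + 2` (`TruncatedRightRows`). Hence, exactly as on the torus
(`BootstrapReflectionCutLevels`), on `ℤ^d`:

* ★★★ `isBootstrapFeasible_comp_reflect_suN` — a level-`(n+2)` solution composed with ANY element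
  `Θ_s` of `ℤ₂^d` is a level-`n` solution; `IsSDFunctional.comp_reflect_suN`,
  `isBootstrapFeasible_poly_comp_reflect_suN` — untruncated: solutions go to solutions;
* ★ `fullSymLevelValuesZdSuN N β n P` — the level-`n` SDP reduced by the whole of `B_d ⋉ ℤ^d`:
  feasible functionals invariant on the words of length `≤ 2n` under all translations, all axis
  permutations and all axis reflections (`⊆ spaceSym ⊆ sym ⊆ plain`;
  `apply_comp_reflectCM_of_forall_single` — then invariant under every `Θ_s`);
* ★★ `dlr_integral_mem_fullSymLevelValuesZd` — SOUND for every Gibbs state invariant under the full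
  space group (`configSiteReflectMeasurableEquiv`);
* ★★★ `spaceSymLevelValuesZd_succ_succ_subset_fullSym_suN` — for an objective `P` of word length
  `≤ 2n + 4` which every axis reflection maps to a TRANSLATE of itself (e.g. any plaquette variable
  `Re tr U_p`, any Wilson loop symmetric under reversal of orientation up to translation):
  `spaceSym_{n+2}(P) ⊆ fullSym_n(P) ⊆ spaceSym_n(P)` (`fullSym_sandwich_suN`) — imposing the
  reflections on top of translations and axis permutations at a fixed level gains AT MOST what two
  more units of word length gain. Mechanism: average a level-`(n+2)` space-group-reduced solution
  over `ℤ₂^d`; translation and permutation invariance survive because `ℤ₂^d` is normalised by both.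

What this is NOT: whether the reflections gain anything at fixed level (strictness of either
inclusion); reflection POSITIVITY (a different, genuine cut: `BootstrapRPCutDensity` etc.); rates.

References: V. Kazakov, Z. Zheng, arXiv:2203.11360 §3.2–3.3; P. Anderson, M. Kruczenski, Nucl.
Phys. B 921 (2017) §3; K. Gatermann, P. A. Parrilo, J. Pure Appl. Algebra 192 (2004) 95, Thm 3.3.
Folklore.
-/

noncomputable section

open MeasureTheory
open Literature.MathematicalPhysics.QuantumFieldTheory (LatticeRep)
open Literature.Probability.LatticeModels (Site)
open Literature.MathematicalPhysics.QuantumLattice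

namespace Summit.QuantumFields.GaugeBoot

section ZdSuN

variable {d : ℕ} (N : ℕ) (β : ℝ)

/-! ## Reflecting solutions -/

/-- The one-link Wilson boundary actions of `SU(N)` are covariant under every `Θ_s`. -/
theorem wilsonBoundaryAction_reflectCovariant_suN (s : Finset (Fin d)) (e : ZdEdge d)
    (U : LGConfig d (Matrix.specialUnitaryGroup (Fin N) ℂ)) :
    (fun e => wilsonBoundaryAction (fundamentalRep (Fin N)) {e}) e
        (revRelabelCM (G := Matrix.specialUnitaryGroup (Fin N) ℂ) (zdReflEdges s) (fun e : ZdEdge d => e.2 ∈ s) U) =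
      (fun e => wilsonBoundaryAction (fundamentalRep (Fin N)) {e}) (zdReflEdges s e) U :=
  wilsonBoundaryAction_single_reflect (fundamentalRep (Fin N)) (continuous_fundamentalRep _) s e U

/-- ★★★ **A level-`(n+2)` solution reflected by any `Θ_s ∈ ℤ₂^d` is a level-`n` solution** (`SU(N)`
on `ℤ^d`, any `β`): the left rows of the reversed links are right rows, which level `n + 2`
supplies at level `n` (`isRightRowsOn_of_isBootstrapFeasible_suN`). [folklore] -/
theorem isBootstrapFeasible_comp_reflect_suN (s : Finset (Fin d)) {n : ℕ}
    {φ : C(LGConfig d (Matrix.specialUnitaryGroup (Fin N) ℂ), ℝ) →ₗ[ℝ] ℝ}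
    (hφ : IsBootstrapFeasible (fundamentalLatticeRep N) (suExp N)
      (fun e => wilsonBoundaryAction (fundamentalRep (Fin N)) {e}) β
      (wordTruncation (ι := ZdEdge d) (fundamentalLatticeRep N) (n + 2)) φ) :
    IsBootstrapFeasible (fundamentalLatticeRep N) (suExp N)
      (fun e => wilsonBoundaryAction (fundamentalRep (Fin N)) {e}) β
      (wordTruncation (ι := ZdEdge d) (fundamentalLatticeRep N) n)
      (φ ∘ₗ (ContinuousMap.compRightAlgHom ℝ ℝ
        (reflectCM (G := Matrix.specialUnitaryGroup (Fin N) ℂ) s)).toLinearMap) :=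
  hφ.comp_revRelabel_of_rightRows (fundamentalLatticeRep N) (zdReflEdges s) (fun e : ZdEdge d => e.2 ∈ s)
    (zdReflEdges_injective s) (wilsonBoundaryAction_reflectCovariant_suN N s) (suExp_add N)
    (wordTruncation_mono _ (by omega))
    (fun _ hv => comp_reflectCM_mem_wordTruncation s (fundamentalLatticeRep N) n hv)
    (isRightRowsOn_of_isBootstrapFeasible_suN N
      (fun e => wilsonBoundaryAction_mem_polyFunctions (fundamentalLatticeRep N) {e}) hφ)

/-- ★★ **Untruncated: a Schwinger–Dyson functional reflected by any `Θ_s` is one** (`SU(N)` on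
`ℤ^d`; the right loop equations follow from the left ones, `IsSDFunctional.isRightSDFunctional_suN`).
[folklore] -/
theorem IsSDFunctional.comp_reflect_suN (s : Finset (Fin d))
    {φ : C(LGConfig d (Matrix.specialUnitaryGroup (Fin N) ℂ), ℝ) →ₗ[ℝ] ℝ}
    (hφ : IsSDFunctional (fundamentalLatticeRep N) (suExp N)
      (fun e => wilsonBoundaryAction (fundamentalRep (Fin N)) {e}) β φ) :
    IsSDFunctional (fundamentalLatticeRep N) (suExp N)
      (fun e => wilsonBoundaryAction (fundamentalRep (Fin N)) {e}) β
      (φ ∘ₗ (ContinuousMap.compRightAlgHom ℝ ℝ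
        (reflectCM (G := Matrix.specialUnitaryGroup (Fin N) ℂ) s)).toLinearMap) :=
  hφ.comp_revRelabel (fundamentalLatticeRep N) (zdReflEdges s) (fun e : ZdEdge d => e.2 ∈ s)
    (zdReflEdges_injective s) (wilsonBoundaryAction_reflectCovariant_suN N s) (suExp_add N)
    (hφ.isRightSDFunctional_suN N
      (fun e => wilsonBoundaryAction_mem_polyFunctions (fundamentalLatticeRep N) {e}))

/-- ★★ **Untruncated bootstrap solutions go to solutions under every `Θ_s`.** -/
theorem isBootstrapFeasible_poly_comp_reflect_suN (s : Finset (Fin d))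
    {φ : C(LGConfig d (Matrix.specialUnitaryGroup (Fin N) ℂ), ℝ) →ₗ[ℝ] ℝ}
    (hφ : IsBootstrapFeasible (fundamentalLatticeRep N) (suExp N)
      (fun e => wilsonBoundaryAction (fundamentalRep (Fin N)) {e}) β
      (polyAlgebra (ι := ZdEdge d) (fundamentalLatticeRep N) : Set _) φ) :
    IsBootstrapFeasible (fundamentalLatticeRep N) (suExp N)
      (fun e => wilsonBoundaryAction (fundamentalRep (Fin N)) {e}) β
      (polyAlgebra (ι := ZdEdge d) (fundamentalLatticeRep N) : Set _)
      (φ ∘ₗ (ContinuousMap.compRightAlgHom ℝ ℝ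
        (reflectCM (G := Matrix.specialUnitaryGroup (Fin N) ℂ) s)).toLinearMap) :=
  hφ.comp_revRelabel_of_rightRows (fundamentalLatticeRep N) (zdReflEdges s) (fun e : ZdEdge d => e.2 ∈ s)
    (zdReflEdges_injective s) (wilsonBoundaryAction_reflectCovariant_suN N s) (suExp_add N) subset_rfl
    (fun _ hv => comp_reflectCM_mem_polyAlgebra s (fundamentalLatticeRep N) hv)
    ((isRightRowsOn_polyAlgebra_iff (fundamentalLatticeRep N)).2
      (IsSDFunctional.isRightSDFunctional_suN N
        (fun e => wilsonBoundaryAction_mem_polyFunctions (fundamentalLatticeRep N) {e}) hφ.2.2))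

/-! ## The fully reduced SDP -/

/-- ★ **The level-`n` SDP on `ℤ^d` reduced by the full hyperoctahedral space group `B_d ⋉ ℤ^d`**:
level-`n` feasible functionals invariant on the words of length `≤ 2n` under all translations, all
axis permutations and all axis reflections. [folklore] -/
def fullSymLevelValuesZdSuN (n : ℕ) (P : C(LGConfig d (Matrix.specialUnitaryGroup (Fin N) ℂ), ℝ)) : Set ℝ :=
  {t | ∃ φ : C(LGConfig d (Matrix.specialUnitaryGroup (Fin N) ℂ), ℝ) →ₗ[ℝ] ℝ,
    IsBootstrapFeasible (fundamentalLatticeRep N) (suExp N)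
        (fun e => wilsonBoundaryAction (fundamentalRep (Fin N)) {e}) β
        (wordTruncation (ι := ZdEdge d) (fundamentalLatticeRep N) n) φ ∧
      (∀ (v : Fin d → ℤ), ∀ x ∈ wordTruncation (ι := ZdEdge d) (fundamentalLatticeRep N) (n + n),
        φ (x.comp (relabelCM (G := Matrix.specialUnitaryGroup (Fin N) ℂ) (edgeShift v))) = φ x) ∧
      (∀ (σ : Equiv.Perm (Fin d)), ∀ x ∈ wordTruncation (ι := ZdEdge d) (fundamentalLatticeRep N) (n + n),
        φ (x.comp (relabelCM (G := Matrix.specialUnitaryGroup (Fin N) ℂ) (edgePerm σ))) = φ x) ∧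
      (∀ (i : Fin d), ∀ x ∈ wordTruncation (ι := ZdEdge d) (fundamentalLatticeRep N) (n + n),
        φ (x.comp (zdSiteReflectCM (G := Matrix.specialUnitaryGroup (Fin N) ℂ) i)) = φ x) ∧
      φ P = t}

/-- The reflections shrink the feasible set further: `fullSym ⊆ spaceSym`. -/
theorem fullSymLevelValuesZd_subset_spaceSymLevelValuesZd (n : ℕ)
    (P : C(LGConfig d (Matrix.specialUnitaryGroup (Fin N) ℂ), ℝ)) :
    fullSymLevelValuesZdSuN (d := d) N β n P ⊆ spaceSymLevelValuesZdSuN (d := d) N β n P := by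
  rintro t ⟨φ, hφ, hT, hperm, -, rfl⟩
  exact ⟨φ, hφ, hT, hperm, rfl⟩

/-- **Invariance under the generators `Θ_i` on a reflection-stable set gives invariance under all
of `ℤ₂^d`.** -/
theorem apply_comp_reflectCM_of_forall_single {V : Set C(LGConfig d (Matrix.specialUnitaryGroup (Fin N) ℂ), ℝ)}
    (hV : ∀ (i : Fin d), ∀ x ∈ V, x.comp (zdSiteReflectCM (G := Matrix.specialUnitaryGroup (Fin N) ℂ) i) ∈ V)
    {φ : C(LGConfig d (Matrix.specialUnitaryGroup (Fin N) ℂ), ℝ) →ₗ[ℝ] ℝ}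
    (h : ∀ (i : Fin d), ∀ x ∈ V, φ (x.comp (zdSiteReflectCM (G := Matrix.specialUnitaryGroup (Fin N) ℂ) i)) = φ x)
    (s : Finset (Fin d)) : ∀ x ∈ V, φ (x.comp (reflectCM (G := Matrix.specialUnitaryGroup (Fin N) ℂ) s)) = φ x := by
  induction s using Finset.induction_on with
  | empty => intro x _; rw [reflectCM_empty, ContinuousMap.comp_id]
  | insert i s hi ih =>
    intro x hx
    rw [reflectCM_insert s hi, ← ContinuousMap.comp_assoc, ih _ (hV i x hx), h i x hx]

/-! ## Soundness for the fully symmetric phases -/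

/-- The axis reflection of configurations as a measurable involution. -/
def configSiteReflectMeasurableEquiv (i : Fin d) :
    LGConfig d (Matrix.specialUnitaryGroup (Fin N) ℂ) ≃ᵐ LGConfig d (Matrix.specialUnitaryGroup (Fin N) ℂ) where
  toFun := configSiteReflect i
  invFun := configSiteReflect i
  left_inv := configSiteReflect_configSiteReflect i
  right_inv := configSiteReflect_configSiteReflect i
  measurable_toFun := measurable_configSiteReflect i
  measurable_invFun := measurable_configSiteReflect i

/-- ★★ **Soundness for the fully symmetric phases**: a Gibbs state invariant under translations,
axis permutations and axis reflections is fully-reduced feasible at every level. [folklore] -/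
theorem dlr_integral_mem_fullSymLevelValuesZd (n : ℕ)
    {μ : Measure (LGConfig d (Matrix.specialUnitaryGroup (Fin N) ℂ))}
    (hμ : μ ∈ ymGibbsMeasures (d := d) (fundamentalRep (Fin N)) β) (hT : IsZdTranslationInvariant μ)
    (hperm : ∀ σ : Equiv.Perm (Fin d), μ.map (relabelConfig (edgePerm σ)) = μ)
    (hrefl : ∀ i : Fin d, μ.map (configSiteReflect i) = μ)
    (P : C(LGConfig d (Matrix.specialUnitaryGroup (Fin N) ℂ), ℝ)) :
    ∫ U, P U ∂μ ∈ fullSymLevelValuesZdSuN (d := d) N β n P := by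
  obtain ⟨φ, hφ, hTφ, hpermφ, hφP⟩ := dlr_integral_mem_spaceSymLevelValuesZd N β n hμ hT hperm P
  haveI := hμ.1
  refine ⟨expectationFunctional μ, isBootstrapFeasible_dlr_suN N β hμ (wordTruncation_subset_polyAlgebra _ n),
    fun v x _ => ?_, fun σ x _ => ?_, fun i x _ => ?_, rfl⟩
  · rw [expectationFunctional_apply, expectationFunctional_apply]
    have hmp : MeasurePreserving (configShift (G := Matrix.specialUnitaryGroup (Fin N) ℂ) (-v)) μ μ :=
      ⟨(configShift _).measurable, hT (-v)⟩
    have h := hmp.integral_comp (configShift (-v)).measurableEmbedding (fun U => x U)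
    simp only [ContinuousMap.comp_apply, relabelCM_edgeShift_eq_configShift]
    exact h
  · rw [expectationFunctional_apply, expectationFunctional_apply]
    have hmp : MeasurePreserving
        (relabelConfig (G := Matrix.specialUnitaryGroup (Fin N) ℂ) (edgePerm σ⁻¹)) μ μ :=
      ⟨(relabelConfig _).measurable, hperm σ⁻¹⟩
    have h := hmp.integral_comp (relabelConfig (edgePerm σ⁻¹)).measurableEmbedding (fun U => x U)
    simp only [ContinuousMap.comp_apply, relabelCM_edgePerm_eq_relabelConfig]
    exact h
  · rw [expectationFunctional_apply, expectationFunctional_apply]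
    have hmp : MeasurePreserving (configSiteReflectMeasurableEquiv (d := d) N i) μ μ :=
      ⟨(configSiteReflectMeasurableEquiv N i).measurable, hrefl i⟩
    have h := hmp.integral_comp (configSiteReflectMeasurableEquiv N i).measurableEmbedding (fun U => x U)
    simp only [ContinuousMap.comp_apply, zdSiteReflectCM_apply]
    exact h

/-! ## The sandwich: reflections cost at most two levels -/

/-- An objective mapped by every axis reflection to a translate of itself is mapped by every
`Θ_s ∈ ℤ₂^d` to a translate of itself. -/
theorem exists_comp_reflectCM_eq_comp_edgeShift {P : C(LGConfig d (Matrix.specialUnitaryGroup (Fin N) ℂ), ℝ)}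
    (hrefl : ∀ i : Fin d, ∃ v : Fin d → ℤ,
      P.comp (zdSiteReflectCM (G := Matrix.specialUnitaryGroup (Fin N) ℂ) i) =
        P.comp (relabelCM (G := Matrix.specialUnitaryGroup (Fin N) ℂ) (edgeShift v)))
    (s : Finset (Fin d)) :
    ∃ v : Fin d → ℤ, P.comp (reflectCM (G := Matrix.specialUnitaryGroup (Fin N) ℂ) s) =
      P.comp (relabelCM (G := Matrix.specialUnitaryGroup (Fin N) ℂ) (edgeShift v)) := by
  induction s using Finset.induction_on with
  | empty =>
    refine ⟨0, ?_⟩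
    ext U
    simp only [ContinuousMap.comp_apply, reflectCM_empty, ContinuousMap.id_apply]
    congr 1
    funext e
    simp
  | insert i s hi ih =>
    obtain ⟨w, hw⟩ := ih
    obtain ⟨v, hv⟩ := hrefl i
    refine ⟨w + zdReflect s v, ?_⟩
    rw [reflectCM_insert s hi, ← ContinuousMap.comp_assoc, hv, comp_edgeShift_comp_reflectCM, hw,
      comp_relabelCM_edgeShift_comp]

/-- ★★★ **Reflections cost at most two levels on `ℤ^d`.** `SU(N)`, any `β`, `P` a combination of
words of length `≤ 2n + 4` which every axis reflection maps to a translate of itself: every value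
of the level-`(n+2)` SDP reduced by translations and axis permutations is a value of the level-`n`
SDP reduced by the FULL space group `B_d ⋉ ℤ^d` (average of a level-`(n+2)` solution over `ℤ₂^d`:
each reflected functional is level-`n` feasible; translation and permutation invariance survive
since both normalise `ℤ₂^d`; the value of `P` is kept since its reflections are translates).
[folklore] -/
theorem spaceSymLevelValuesZd_succ_succ_subset_fullSym_suN {n : ℕ}
    {P : C(LGConfig d (Matrix.specialUnitaryGroup (Fin N) ℂ), ℝ)}
    (hP : P ∈ wordTruncation (ι := ZdEdge d) (fundamentalLatticeRep N) (n + 2 + (n + 2)))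
    (hrefl : ∀ i : Fin d, ∃ v : Fin d → ℤ,
      P.comp (zdSiteReflectCM (G := Matrix.specialUnitaryGroup (Fin N) ℂ) i) =
        P.comp (relabelCM (G := Matrix.specialUnitaryGroup (Fin N) ℂ) (edgeShift v))) :
    spaceSymLevelValuesZdSuN (d := d) N β (n + 2) P ⊆ fullSymLevelValuesZdSuN (d := d) N β n P := by
  rintro t ⟨φ, hφ, hT, hperm, rfl⟩
  set R : Finset (Fin d) → C(LGConfig d (Matrix.specialUnitaryGroup (Fin N) ℂ),
      LGConfig d (Matrix.specialUnitaryGroup (Fin N) ℂ)) :=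
    fun s => reflectCM (G := Matrix.specialUnitaryGroup (Fin N) ℂ) s with hRdef
  have hW : ∀ {x}, x ∈ wordTruncation (ι := ZdEdge d) (fundamentalLatticeRep N) (n + n) →
      ∀ s, x.comp (R s) ∈ wordTruncation (ι := ZdEdge d) (fundamentalLatticeRep N) (n + 2 + (n + 2)) :=
    fun hx s => comp_reflectCM_mem_wordTruncation s _ _ (wordTruncation_mono _ (by omega) hx)
  refine ⟨avgFunctional R φ, isBootstrapFeasible_avgFunctional (fundamentalLatticeRep N) R
      (fun s => isBootstrapFeasible_comp_reflect_suN N β s hφ), fun v x hx => ?_, fun σ x hx => ?_,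
    fun i x _ => ?_, ?_⟩
  · -- translation invariance survives: `Θ_s` normalises the translations
    rw [avgFunctional_apply, avgFunctional_apply]
    congr 1
    refine Finset.sum_congr rfl fun s _ => ?_
    simp only [hRdef]
    rw [comp_edgeShift_comp_reflectCM]
    exact hT (zdReflect s v) _ (hW hx s)
  · -- permutation invariance survives: `σ` conjugates `ℤ₂^d`, reindex the average
    rw [avgFunctional_apply, avgFunctional_apply]
    congr 1
    have h : ∀ s : Finset (Fin d), φ ((x.comp (relabelCM (edgePerm σ))).comp (R s)) =
        φ (x.comp (R (s.map σ.symm.toEmbedding))) := fun s => by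
      simp only [hRdef]
      rw [comp_edgePerm_comp_reflectCM]
      exact hperm σ _ (hW hx _)
    simp only [h]
    exact Fintype.sum_equiv (Equiv.finsetCongr σ.symm) _ _ fun s => by
      rw [Equiv.finsetCongr_apply]
  · -- reflection invariance: composing with `Θ_i = R {i}` permutes the family
    have h := avgFunctional_comp_eq R (fun δ => exists_equiv_reflectCM_comp δ) φ {i} x
    simp only [hRdef, reflectCM_singleton] at h
    exact h
  · -- the value of `P`: each `P ∘ Θ_s` is a translate of `P`
    rw [avgFunctional_apply]
    have h : ∀ s : Finset (Fin d), φ (P.comp (R s)) = φ P := fun s => by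
      obtain ⟨v, hv⟩ := exists_comp_reflectCM_eq_comp_edgeShift N hrefl s
      simp only [hRdef]
      rw [hv]
      exact hT v P hP
    simp only [h, Finset.sum_const, Finset.card_univ, nsmul_eq_mul]
    have hc : (Fintype.card (Finset (Fin d)) : ℝ) ≠ 0 := Nat.cast_ne_zero.2 Fintype.card_ne_zero
    field_simp

/-- ★★★ **The sandwich**: `spaceSym_{n+2}(P) ⊆ fullSym_n(P) ⊆ spaceSym_n(P)` — imposing the axis
reflections on top of translations and axis permutations at a fixed level gains AT MOST what two
more units of word length gain. [folklore] -/
theorem fullSym_sandwich_suN {n : ℕ}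
    {P : C(LGConfig d (Matrix.specialUnitaryGroup (Fin N) ℂ), ℝ)}
    (hP : P ∈ wordTruncation (ι := ZdEdge d) (fundamentalLatticeRep N) (n + 2 + (n + 2)))
    (hrefl : ∀ i : Fin d, ∃ v : Fin d → ℤ,
      P.comp (zdSiteReflectCM (G := Matrix.specialUnitaryGroup (Fin N) ℂ) i) =
        P.comp (relabelCM (G := Matrix.specialUnitaryGroup (Fin N) ℂ) (edgeShift v))) :
    spaceSymLevelValuesZdSuN (d := d) N β (n + 2) P ⊆ fullSymLevelValuesZdSuN (d := d) N β n P ∧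
      fullSymLevelValuesZdSuN (d := d) N β n P ⊆ spaceSymLevelValuesZdSuN (d := d) N β n P :=
  ⟨spaceSymLevelValuesZd_succ_succ_subset_fullSym_suN N β hP hrefl,
    fullSymLevelValuesZd_subset_spaceSymLevelValuesZd N β n P⟩

/-- ★★ **The fully reduced SDP is feasible at every level** (for such objectives). -/
theorem fullSymLevelValuesZd_nonempty {n : ℕ}
    {P : C(LGConfig d (Matrix.specialUnitaryGroup (Fin N) ℂ), ℝ)}
    (hP : P ∈ wordTruncation (ι := ZdEdge d) (fundamentalLatticeRep N) (n + 2 + (n + 2)))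
    (hrefl : ∀ i : Fin d, ∃ v : Fin d → ℤ,
      P.comp (zdSiteReflectCM (G := Matrix.specialUnitaryGroup (Fin N) ℂ) i) =
        P.comp (relabelCM (G := Matrix.specialUnitaryGroup (Fin N) ℂ) (edgeShift v))) :
    (fullSymLevelValuesZdSuN (d := d) N β n P).Nonempty :=
  (spaceSymLevelValuesZd_nonempty N β (n + 2) hP).mono
    (spaceSymLevelValuesZd_succ_succ_subset_fullSym_suN N β hP hrefl)

/-- A translated configuration's plaquette variable is the plaquette variable at the translated
base point. -/
theorem plaquetteObs_relabelCM_edgeShift (x w : Fin d → ℤ) (a b : Fin d)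
    (U : LGConfig d (Matrix.specialUnitaryGroup (Fin N) ℂ)) :
    plaquetteObs (fundamentalRep (Fin N)) x a b
        (relabelCM (G := Matrix.specialUnitaryGroup (Fin N) ℂ) (edgeShift w) U) =
      plaquetteObs (fundamentalRep (Fin N)) (x + w) a b U := by
  simp only [plaquetteObs, plaquetteHolonomyZd, relabelCM_apply, edgeShift_apply, add_right_comm _ _ w]

/-- **Example of an admissible objective: every plaquette variable `Re tr U_p`** is mapped by each
axis reflection to the plaquette variable of the reflected plaquette — a translate of itself. -/
theorem comp_zdSiteReflectCM_eq_of_coe_eq_plaquetteObs (i : Fin d) (p : ZdPlaquette d)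
    {P : C(LGConfig d (Matrix.specialUnitaryGroup (Fin N) ℂ), ℝ)}
    (hP : ⇑P = plaquetteObs (fundamentalRep (Fin N)) p.1 p.2.1.1 p.2.1.2) :
    P.comp (zdSiteReflectCM (G := Matrix.specialUnitaryGroup (Fin N) ℂ) i) =
      P.comp (relabelCM (G := Matrix.specialUnitaryGroup (Fin N) ℂ)
        (edgeShift ((zdReflPlaquette i p).1 - p.1))) := by
  obtain ⟨x, ⟨⟨a, b⟩, hab⟩⟩ := p
  have h1 : ∀ V, P V = plaquetteObs (fundamentalRep (Fin N)) x a b V := fun V => congrFun hP V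
  ext U
  rw [ContinuousMap.comp_apply, ContinuousMap.comp_apply, h1, h1, zdSiteReflectCM_apply,
    plaquetteObs_relabelCM_edgeShift, add_sub_cancel]
  have h := plaquetteObs_zdReflPlaquette_siteReflect i (fundamentalRep (Fin N)) (continuous_fundamentalRep _)
    U (zdReflPlaquette i (x, ⟨(a, b), hab⟩))
  rw [zdReflPlaquette_zdReflPlaquette] at h
  exact h

end ZdSuN

end Summit.QuantumFields.GaugeBoot

end
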